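import Literature.Barriers.ValiantsHypothesis.BILPS19HQuadNPHardProofs
import Literature.Computability.AlgebraicComplexity.RankOneDeterminantalExpressionsProofs
import HarnessLib

/-!
# Bläser–Ikenmeyer–Lysikov–Pandey–Schreyer 2019, Cor 35: `HMinRank1` is NP-hard — proofs

Sibling proof file of `BILPS19MembershipHardness.lean` (val-lit X5), sequel of
`BILPS19HQuadNPHardProofs.lean` (Thm 33). Discharges the named fact
`BILPS2019_cor35 F : IsNPHard (hmr1Language F)` ("Let `F` be a field and `K` be an effective subfield
of `F`. Then `HMinRank1_{K,F}` is NP-hard", arXiv:1911.02534 p0033:L95; "even deciding whether the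
minrank is `≤ 1` is already NP-hard", §2.5) for EVERY field `F`.

Printed route: Cor 35 = Thm 33 (`HQuad` is NP-hard, from 3-colourability) + Thm 34 (`HQuad ≤ₚ
HMinRank1`: "a set of `k` [quadratic] forms … corresponds to a linear map `L : Sym² Fⁿ → Fᵏ` …; its
kernel has a basis consisting of vectors in `Sym² Sⁿ`, which can be computed in polynomial time. Let
`A_1, …, A_m` be such basis and `T = Σ e_i ⊗ A_i` … Nontrivial common zeros `x` … correspond to rank `1`
symmetric matrices `x ⊗ x` … presented as … a contraction `Ty` with nonzero `y`", p0033:L82–L92).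
THIS FILE composes the two printed steps into ONE Karp map `THREECOL ≤ₚ HMinRank1`, applying Thm 34's
construction to the Thm-33 system of a graph — for which the kernel basis needs no Gaussian
elimination: the constraints `⟨Q, S⟩ = 0` (one per form `Q`, `S ∈ Sym²(F^{2n+1})`) are already in
solved form with pairwise distinct pivot coordinates,
  `s_{x_v y_v} = 0`, `s_{x_v z} = s_{x_v x_v}`, `s_{y_v z} = s_{y_v y_v}` (`v ∈ V`),
  `s_{x_v y_w} = s_{x_v x_v} + s_{y_v y_v} + s_{x_w x_w} + s_{y_w y_w} − s_{x_w y_v} − s_{zz}`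
  (`vw ∈ E`, `v < w`),
so the basis matrices `B_f` (one per free coordinate `f`, `{0, ±1}` entries) are EXPLICIT
(`BILPS19HMinRank1.basisEntry`). DEVIATION FROM PRINT, disclosed: Thm 34's general polynomial-time
kernel computation (Thm 32, linear algebra over an effective field on codes) is NOT formalised; the
named fact `BILPS2019_thm34` stays open; Cor 35 is obtained by the printed chain with the kernel step
carried out symbolically on the Thm-33 instances.

* §K (kernel of the Thm-33 system): the pairing `⟨Q, S⟩` of a coefficient list with a matrix
  (`pairForm`; `quadFormOfList Q u = ⟨Q, u uᵀ⟩`), its value on each form of the instance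
  (`pair_vertex₀/₁/₂`, `pair_slot_none/kill/edge`), the kernel predicate `InKer` and its solved form
  `KerRel` for graph codes (`inKer_iff_kerRel`); pivots / free coordinates (`isPivot`, `isFree`,
  `freeList`), the basis matrices (`basisEntry`, `basisMat`), and the three facts: every `B_f` is a
  symmetric kernel element (`kerRel_basisMat`), kernel elements are spanned (`eq_sum_basisMat`), and
  the `B_f` are independent (`sum_basisMat_apply_free`);
* §E (the printed equivalence of Thm 34 on these instances): `∃ y ≠ 0, rk(Σ y_f B_f) ≤ 1` iff the
  graph is 3-colourable (`exists_rank_le_one_iff`; rank-one symmetric `S = u vᵀ` forces `v = λ u`,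
  tree lemma `exists_vecMulVec_of_rank_le_one`, then Thm 33's `BILPS19HQuad.exists_common_zero_iff` /
  `exists_isSolution_iff`);
* §M (the machine, `CodeFP`): the instance `(2n+1, #free, entries, 1)` in the format of
  `tensorInstEncoding` / `hmrTensorOfList`, computed on graph codes by `filter`/`map`/`brange` under a
  unary budget; ill-formed strings and non-graph bit matrices (a killing slot of Thm 33's instance
  fires) go to non-members;
* §D: `BILPS19HMinRank1.THREECOL_karpReducible_hmr1Language`, **`BILPS2019_cor35_holds`**.
* §G: the same map read in Problem 2: `BILPS19HMinRank1.THREECOL_karpReducible_hmrLanguage`,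
  **`BILPS2019_hmr_isNPHard : IsNPHard (hmrLanguage F)`** (§1.1/§2.5 "membership in the minrank
  varieties is NP-hard", every field).

Theorem-only file (proof-plumbing `def`s; no statement of `BILPS19MembershipHardness.lean` is touched,
no new fact). HONEST FRAMING (val-lit): typed literature; `VP ≠ VNP` is NOT proved and nothing here
is progress on it.

## References

* [BlaserIkenmeyerLysikovPandeySchreyer2019] arXiv:1911.02534, §8.1: Problem 3, Thm 33, Thm 34 and
  its proof (p0033:L77–L92), Cor 35 (p0033:L95); §2.5.
* [GareyJohnson1979] A1.1 GT4 (GRAPH 3-COLORABILITY).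
* [AroraBarak2009] Def. 2.7 / Thm. 2.8, §1.3, §0.1.
-/

noncomputable section

namespace Literature.Barriers.ValiantsHypothesis

open Literature.Computability.AlgebraicComplexity Literature.Computability.Complexity
open _root_.Computability Matrix
open scoped Literature.Computability.Complexity.Notation

universe u

namespace BILPS19HMinRank1

open BILPS19HQuad

/-! ### §K. The kernel of the Thm-33 system in `Sym²(F^{2n+1})` -/

section Kernel

variable {F : Type u} [Field F]

/-- **The pairing `⟨Q, S⟩ = Σ_{i,j} Q_{ij} S_{ij}`** of a row-major coefficient list with a matrix —
the linear form on `Fⁿ ⊗ Fⁿ` "corresponding" to the quadratic form `Q` (Thm 34, proof: "a vector `x`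
is a zero of `q` if and only if `x ⊗ x` is a zero of `Q`").
[cite: BlaserIkenmeyerLysikovPandeySchreyer2019, Thm. 34 (proof)] -/
def pairForm {N : ℕ} (l : List ℤ) (S : Matrix (Fin N) (Fin N) F) : F :=
  ∑ i : Fin N, ∑ j : Fin N, ((l.getD (i.1 * N + j.1) 0 : ℤ) : F) * S i j

/-- "`x` is a zero of `q` if and only if `x ⊗ x` is a zero of `Q`": `q(u) = ⟨Q, u uᵀ⟩`.
[cite: BlaserIkenmeyerLysikovPandeySchreyer2019, Thm. 34 (proof)] -/
theorem quadFormOfList_eq_pairForm {N : ℕ} (l : List ℤ) (u : Fin N → F) :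
    quadFormOfList F N l u = pairForm l (vecMulVec u u) := by
  simp only [quadFormOfList, pairForm, vecMulVec_apply, mul_assoc]

/-- The pairing is linear in the matrix: addition. [cite: BlaserIkenmeyerLysikovPandeySchreyer2019, Thm. 34 (proof)] -/
theorem pairForm_add {N : ℕ} (l : List ℤ) (S T : Matrix (Fin N) (Fin N) F) :
    pairForm l (S + T) = pairForm l S + pairForm l T := by
  simp only [pairForm, Matrix.add_apply, mul_add, Finset.sum_add_distrib]

/-- The pairing is linear in the matrix: sums. [cite: BlaserIkenmeyerLysikovPandeySchreyer2019, Thm. 34 (proof)] -/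
theorem pairForm_sum {N : ℕ} {ι : Type*} (s : Finset ι) (l : List ℤ) (S : ι → Matrix (Fin N) (Fin N) F) :
    pairForm l (∑ a ∈ s, S a) = ∑ a ∈ s, pairForm l (S a) := by
  classical
  induction s using Finset.induction_on with
  | empty => simp [pairForm]
  | insert a s ha ih => rw [Finset.sum_insert ha, Finset.sum_insert ha, pairForm_add, ih]

/-- The pairing is linear in the matrix: scalars. [cite: BlaserIkenmeyerLysikovPandeySchreyer2019, Thm. 34 (proof)] -/
theorem pairForm_smul {N : ℕ} (l : List ℤ) (c : F) (S : Matrix (Fin N) (Fin N) F) :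
    pairForm l (c • S) = c * pairForm l S := by
  simp only [pairForm, Matrix.smul_apply, smul_eq_mul, Finset.mul_sum]
  exact Finset.sum_congr rfl fun i _ => Finset.sum_congr rfl fun j _ => by ring

/-- Entries of a matrix by natural-number indices (`0` outside the square). [folklore] -/
def entryAt {N : ℕ} (S : Matrix (Fin N) (Fin N) F) (k l : ℕ) : F :=
  if h : k < N ∧ l < N then S ⟨k, h.1⟩ ⟨l, h.2⟩ else 0

/-- Reading an entry of a form back from its list. [folklore] -/
private theorem getD_formOf (n : ℕ) (b : List Bool) (q : ℕ) (i j : Fin (nvars n)) :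
    (formOf n b q).getD (i.1 * nvars n + j.1) 0 = entryOf n b q i j := by
  have hlt : i.1 * nvars n + j.1 < nvars n * nvars n := by
    calc i.1 * nvars n + j.1 < i.1 * nvars n + nvars n := by have := j.2; omega
      _ = (i.1 + 1) * nvars n := by ring
      _ ≤ nvars n * nvars n := Nat.mul_le_mul_right _ (by have := i.2; omega)
  rw [formOf, List.getD_eq_getElem _ _ (by rw [List.length_map, List.length_range]; exact hlt),
    List.getElem_map, List.getElem_range]
  have hN : 0 < nvars n := by unfold nvars; omega
  congr 1
  · rw [Nat.add_comm, Nat.add_mul_div_right _ _ hN, Nat.div_eq_of_lt j.2, zero_add]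
  · rw [Nat.add_comm, Nat.add_mul_mod_self_right, Nat.mod_eq_of_lt j.2]

/-- A single indicator against `S_{ij}` picks `S_{ab}`. [folklore] -/
private theorem sum_sum_indicator₂ {N : ℕ} (S : Matrix (Fin N) (Fin N) F) (c : F) (a b : ℕ)
    (ha : a < N) (hb : b < N) :
    ∑ i : Fin N, ∑ j : Fin N, (if (i : ℕ) = a ∧ (j : ℕ) = b then c else 0) * S i j =
      c * entryAt S a b := by
  rw [Finset.sum_eq_single ⟨a, ha⟩ (fun i _ hi => Finset.sum_eq_zero fun j _ => by
      have : ¬ ((i : ℕ) = a ∧ (j : ℕ) = b) := fun h => hi (Fin.ext h.1)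
      rw [if_neg this, zero_mul]) (fun h => absurd (Finset.mem_univ _) h)]
  rw [Finset.sum_eq_single ⟨b, hb⟩ (fun j _ hj => by
      have : ¬ ((a : ℕ) = a ∧ (j : ℕ) = b) := fun h => hj (Fin.ext h.2)
      rw [if_neg this, zero_mul]) (fun h => absurd (Finset.mem_univ _) h)]
  simp [entryAt, ha, hb]

/-- A position listed nowhere has entry `0`. [folklore] -/
private theorem firstMatch_eq_zero' {T : List (ℤ × ℕ × ℕ)} {i j : ℕ}
    (h : ∀ t ∈ T, ¬ (i = t.2.1 ∧ j = t.2.2)) : firstMatch T i j = 0 := by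
  induction T with
  | nil => rfl
  | cons t T ih =>
    rw [firstMatch, List.foldr_cons, if_neg (h t List.mem_cons_self)]
    exact ih fun t' ht' => h t' (List.mem_cons_of_mem _ ht')

/-- Evaluation of a first-match table with pairwise distinct positions against `S_{ij}`.
[folklore] -/
private theorem sum_sum_firstMatch₂ {N : ℕ} (S : Matrix (Fin N) (Fin N) F) (T : List (ℤ × ℕ × ℕ))
    (hd : T.Pairwise fun s t => s.2 ≠ t.2) (hN : ∀ t ∈ T, t.2.1 < N ∧ t.2.2 < N) :
    ∑ i : Fin N, ∑ j : Fin N, (firstMatch T i j : F) * S i j =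
      (T.map fun t => (t.1 : F) * entryAt S t.2.1 t.2.2).sum := by
  induction T with
  | nil => simp [firstMatch]
  | cons t T ih =>
    rw [List.pairwise_cons] at hd
    have hsplit : ∀ i j : ℕ, (firstMatch (t :: T) i j : F) =
        (if i = t.2.1 ∧ j = t.2.2 then (t.1 : F) else 0) + (firstMatch T i j : F) := by
      intro i j
      rw [firstMatch, List.foldr_cons]
      change ((if i = t.2.1 ∧ j = t.2.2 then t.1 else firstMatch T i j : ℤ) : F) = _
      by_cases h : i = t.2.1 ∧ j = t.2.2
      · have htail : firstMatch T i j = 0 :=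
          firstMatch_eq_zero' fun t' ht' h' => hd.1 t' ht' (Prod.ext (h.1.symm.trans h'.1) (h.2.symm.trans h'.2))
        rw [if_pos h, if_pos h, htail, Int.cast_zero, add_zero]
      · rw [if_neg h, if_neg h, zero_add]
    simp_rw [hsplit, add_mul, Finset.sum_add_distrib]
    rw [sum_sum_indicator₂ S _ _ _ (hN t List.mem_cons_self).1 (hN t List.mem_cons_self).2,
      ih hd.2 fun t' ht' => hN t' (List.mem_cons_of_mem _ ht'), List.map_cons, List.sum_cons]

/-- **The pairing of form `q` with `S`**: the sum of its terms, whenever the positions are pairwise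
distinct and inside the square. [cite: BlaserIkenmeyerLysikovPandeySchreyer2019, Thm. 34 (proof)] -/
theorem pairForm_formOf_eq_sum (n : ℕ) (b : List Bool) (q : ℕ) (S : Matrix (Fin (nvars n)) (Fin (nvars n)) F)
    (hd : (termsOf n b q).Pairwise fun s t => s.2 ≠ t.2)
    (hN : ∀ t ∈ termsOf n b q, t.2.1 < nvars n ∧ t.2.2 < nvars n) :
    pairForm (formOf n b q) S =
      ((termsOf n b q).map fun t => (t.1 : F) * entryAt S t.2.1 t.2.2).sum := by
  unfold pairForm
  rw [← sum_sum_firstMatch₂ S _ hd hN]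
  refine Finset.sum_congr rfl fun i _ => Finset.sum_congr rfl fun j _ => ?_
  rw [getD_formOf]
  rfl

section Values

variable (n : ℕ) (b : List Bool) (S : Matrix (Fin (nvars n)) (Fin (nvars n)) F)

/-- Pairing with vertex form `3u` (`x_u y_u`): `S_{u, n+u}`. [cite: BlaserIkenmeyerLysikovPandeySchreyer2019, Thm. 34 (proof)] -/
theorem pair_vertex₀ {u : ℕ} (hu : u < n) : pairForm (formOf n b (3 * u)) S = entryAt S u (n + u) := by
  rw [pairForm_formOf_eq_sum n b _ S (by rw [termsOf_vertex₀ n b hu]; simp)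
    (by rw [termsOf_vertex₀ n b hu]; simp [nvars]; omega), termsOf_vertex₀ n b hu]
  simp

/-- Pairing with vertex form `3u+1` (`x_u² − x_u z`): `S_{uu} − S_{u,2n}`.
[cite: BlaserIkenmeyerLysikovPandeySchreyer2019, Thm. 34 (proof)] -/
theorem pair_vertex₁ {u : ℕ} (hu : u < n) :
    pairForm (formOf n b (3 * u + 1)) S = entryAt S u u - entryAt S u (2 * n) := by
  rw [pairForm_formOf_eq_sum n b _ S (by rw [termsOf_vertex₁ n b hu]; simp; omega)
    (by rw [termsOf_vertex₁ n b hu]; simp [nvars]; omega), termsOf_vertex₁ n b hu]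
  simp [sub_eq_add_neg]

/-- Pairing with vertex form `3u+2` (`y_u² − y_u z`): `S_{n+u,n+u} − S_{n+u,2n}`.
[cite: BlaserIkenmeyerLysikovPandeySchreyer2019, Thm. 34 (proof)] -/
theorem pair_vertex₂ {u : ℕ} (hu : u < n) :
    pairForm (formOf n b (3 * u + 2)) S = entryAt S (n + u) (n + u) - entryAt S (n + u) (2 * n) := by
  rw [pairForm_formOf_eq_sum n b _ S (by rw [termsOf_vertex₂ n b hu]; simp; omega)
    (by rw [termsOf_vertex₂ n b hu]; simp [nvars]; omega), termsOf_vertex₂ n b hu]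
  simp [sub_eq_add_neg]

/-- Pairing with an unset slot: `0`. [cite: BlaserIkenmeyerLysikovPandeySchreyer2019, Thm. 34 (proof)] -/
theorem pair_slot_none {u w : ℕ} (hu : u < n) (hw : w < n) (h : b.getD (w + n * u) false = false) :
    pairForm (formOf n b (3 * n + (w + n * u))) S = 0 := by
  rw [pairForm_formOf_eq_sum n b _ S (by rw [termsOf_slot_none n b hu hw h]; simp)
    (by rw [termsOf_slot_none n b hu hw h]; simp), termsOf_slot_none n b hu hw h]
  simp

/-- Pairing with a killing slot: `S_{2n,2n}`. [cite: BlaserIkenmeyerLysikovPandeySchreyer2019, Thm. 34 (proof)] -/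
theorem pair_slot_kill {u w : ℕ} (hu : u < n) (hw : w < n) (h : b.getD (w + n * u) false = true)
    (h' : u = w ∨ b.getD (u + n * w) false = false) :
    pairForm (formOf n b (3 * n + (w + n * u))) S = entryAt S (2 * n) (2 * n) := by
  rw [pairForm_formOf_eq_sum n b _ S (by rw [termsOf_slot_kill n b hu hw h h']; simp)
    (by rw [termsOf_slot_kill n b hu hw h h']; simp [nvars]), termsOf_slot_kill n b hu hw h h']
  simp

/-- Pairing with an edge slot: `S_{uu} + S_{n+u,n+u} + S_{ww} + S_{n+w,n+w} − S_{u,n+w} − S_{w,n+u}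
− S_{2n,2n}`. [cite: BlaserIkenmeyerLysikovPandeySchreyer2019, Thm. 34 (proof)] -/
theorem pair_slot_edge {u w : ℕ} (hu : u < n) (hw : w < n) (h : b.getD (w + n * u) false = true)
    (huw : u ≠ w) (h' : b.getD (u + n * w) false = true) :
    pairForm (formOf n b (3 * n + (w + n * u))) S =
      entryAt S u u + entryAt S (n + u) (n + u) + entryAt S w w + entryAt S (n + w) (n + w) -
        entryAt S u (n + w) - entryAt S w (n + u) - entryAt S (2 * n) (2 * n) := by
  rw [pairForm_formOf_eq_sum n b _ S
    (by rw [termsOf_slot_edge n b hu hw h huw h']; simp [edgeTerms]; omega)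
    (by rw [termsOf_slot_edge n b hu hw h huw h']; simp [edgeTerms, nvars]; omega),
    termsOf_slot_edge n b hu hw h huw h']
  simp [edgeTerms]
  ring

end Values

/-- **The kernel `K = {S : ⟨Q, S⟩ = 0 for every form Q of the instance}`** ("a linear map
`L : Sym² Fⁿ → Fᵏ` given by a matrix consisting from the coefficients of quadratic forms", Thm 34,
proof), as a predicate on matrices. [cite: BlaserIkenmeyerLysikovPandeySchreyer2019, Thm. 34 (proof)] -/
def InKer (n : ℕ) (b : List Bool) (S : Matrix (Fin (nvars n)) (Fin (nvars n)) F) : Prop :=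
  ∀ q < 3 * n + n * n, pairForm (formOf n b q) S = 0

/-- **The kernel in solved form** for the system of a graph `G`: `S_{x_v y_v} = 0`,
`S_{x_v x_v} = S_{x_v z}`, `S_{y_v y_v} = S_{y_v z}`, and the edge relations.
[cite: BlaserIkenmeyerLysikovPandeySchreyer2019, Thm. 34 (proof)] -/
def KerRel {n : ℕ} (G : SimpleGraph (Fin n)) (S : Matrix (Fin (nvars n)) (Fin (nvars n)) F) : Prop :=
  (∀ v : Fin n, entryAt S v (n + v) = 0 ∧ entryAt S v v - entryAt S v (2 * n) = 0 ∧
      entryAt S (n + v) (n + v) - entryAt S (n + v) (2 * n) = 0) ∧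
    ∀ v w : Fin n, G.Adj v w →
      entryAt S v v + entryAt S (n + v) (n + v) + entryAt S w w + entryAt S (n + w) (n + w) -
        entryAt S v (n + w) - entryAt S w (n + v) - entryAt S (2 * n) (2 * n) = 0

/-- The slot index of a pair is in range. [folklore] -/
private theorem slot_lt' {n u w : ℕ} (hu : u < n) (hw : w < n) : 3 * n + (w + n * u) < 3 * n + n * n := by
  have : w + n * u < n * n := by
    calc w + n * u < n + n * u := by omega
      _ = n * (u + 1) := by ring
      _ ≤ n * n := Nat.mul_le_mul_left _ (by omega)
  omega

/-- **`K` in solved form** (graph codes: bit `(u, w)` at `w + n u` is `[G.Adj u w]`).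
[cite: BlaserIkenmeyerLysikovPandeySchreyer2019, Thm. 34 (proof)] -/
theorem inKer_iff_kerRel {n : ℕ} (b : List Bool) (G : SimpleGraph (Fin n))
    (hb : ∀ u w : Fin n, b.getD (w + n * u) false = true ↔ G.Adj u w)
    (S : Matrix (Fin (nvars n)) (Fin (nvars n)) F) : InKer n b S ↔ KerRel G S := by
  classical
  constructor
  · intro hq
    refine ⟨fun v => ⟨?_, ?_, ?_⟩, fun v w hvw => ?_⟩
    · have h0 := hq (3 * v) (by have := v.2; omega)
      rwa [pair_vertex₀ n b S v.2] at h0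
    · have h0 := hq (3 * v + 1) (by have := v.2; omega)
      rwa [pair_vertex₁ n b S v.2] at h0
    · have h0 := hq (3 * v + 2) (by have := v.2; omega)
      rwa [pair_vertex₂ n b S v.2] at h0
    · have h1 : b.getD (w + n * v) false = true := (hb v w).2 hvw
      have h2 : b.getD (v + n * w) false = true := (hb w v).2 hvw.symm
      have hne : (v : ℕ) ≠ w := fun e => G.irrefl (by rwa [show w = v from (Fin.ext e).symm] at hvw)
      have h0 := hq _ (slot_lt' v.2 w.2)
      rwa [pair_slot_edge n b S v.2 w.2 h1 hne h2] at h0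
  · rintro ⟨hv, he⟩ q hq
    by_cases hq3 : q < 3 * n
    · set u : Fin n := ⟨q / 3, by omega⟩
      obtain ⟨e0, e1, e2⟩ := hv u
      have hq' : q = 3 * (q / 3) + q % 3 := (Nat.div_add_mod q 3).symm
      have hlt : q % 3 < 3 := Nat.mod_lt _ (by norm_num)
      interval_cases hr : q % 3
      · rw [add_zero] at hq'
        rw [hq', pair_vertex₀ n b S u.2]
        exact e0
      · rw [hq', pair_vertex₁ n b S u.2]
        exact e1
      · rw [hq', pair_vertex₂ n b S u.2]
        exact e2
    · have hn : 0 < n := by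
        rcases Nat.eq_zero_or_pos n with rfl | hn
        · omega
        · exact hn
      set p := q - 3 * n with hp
      have hpq : q = 3 * n + (p % n + n * (p / n)) := by
        have := Nat.div_add_mod p n; omega
      have hun : p / n < n := by
        apply Nat.div_lt_of_lt_mul; rw [hp]; omega
      have hwn : p % n < n := Nat.mod_lt _ hn
      set u : Fin n := ⟨p / n, hun⟩
      set w : Fin n := ⟨p % n, hwn⟩
      rw [hpq]
      rcases hget : b.getD (p % n + n * (p / n)) false with _ | _
      · exact pair_slot_none n b S hun hwn hget
      · have hadj : G.Adj u w := (hb u w).1 hget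
        have hne' : (p / n) ≠ p % n := fun e => G.irrefl (by
          rwa [show w = u from Fin.ext e.symm] at hadj)
        have h2 : b.getD (p / n + n * (p % n)) false = true := (hb w u).2 hadj.symm
        rw [pair_slot_edge n b S hun hwn hget hne' h2]
        exact he u w hadj

/-! #### Pivots, free coordinates, basis matrices -/

/-- **Free coordinates** of `Sym²(F^{2n+1})` (pairs `lo ≤ hi < 2n+1`) — all but the PIVOTS
`x_v y_v = (v, n+v)`, `x_v z = (v, 2n)`, `y_v z = (n+v, 2n)` and `x_v y_w = (v, n+w)` (`v < w`, bit
`(v, w)` set); Boolean, the machine's shape. [cite: BlaserIkenmeyerLysikovPandeySchreyer2019, Thm. 34 (proof: basis of the kernel)] -/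
def isFree (n : ℕ) (b : List Bool) (p : ℕ × ℕ) : Bool :=
  decide (p.1 ≤ p.2) && decide (p.2 < nvars n) && !(decide (p.1 < n) && decide (p.2 = n + p.1)) &&
    !(decide (p.2 = 2 * n) && decide (p.1 < 2 * n)) &&
    !(decide (p.1 < n) && decide (n ≤ p.2) && decide (p.2 < 2 * n) && decide (p.1 < p.2 - n) &&
      b.getD (p.2 - n + n * p.1) false)

/-- Unfolding of the free-coordinate test. [folklore] -/
private theorem isFree_iff {n : ℕ} {b : List Bool} {lo hi : ℕ} : isFree n b (lo, hi) = true ↔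
    lo ≤ hi ∧ hi < nvars n ∧ ¬ (lo < n ∧ hi = n + lo) ∧ ¬ (hi = 2 * n ∧ lo < 2 * n) ∧
      ¬ (lo < n ∧ n ≤ hi ∧ hi < 2 * n ∧ lo < hi - n ∧ b.getD (hi - n + n * lo) false = true) := by
  unfold isFree
  dsimp only
  cases b.getD (hi - n + n * lo) false <;> simp <;> omega

/-- The list of free coordinates, in row-major order.
[cite: BlaserIkenmeyerLysikovPandeySchreyer2019, Thm. 34 (proof: basis of the kernel)] -/
def freeList (n : ℕ) (b : List Bool) : List (ℕ × ℕ) :=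
  ((List.range (nvars n * nvars n)).map fun t => (t / nvars n, t % nvars n)).filter (isFree n b)

/-- Membership in the free list is the free test. [folklore] -/
private theorem mem_freeList_iff {n : ℕ} {b : List Bool} {f : ℕ × ℕ} : f ∈ freeList n b ↔ isFree n b f = true := by
  have hN : 0 < nvars n := by unfold nvars; omega
  simp only [freeList, List.mem_filter, List.mem_map, List.mem_range]
  constructor
  · exact fun h => h.2
  · intro h
    refine ⟨⟨f.1 * nvars n + f.2, ?_, ?_⟩, h⟩
    · obtain ⟨f1, f2⟩ := f
      obtain ⟨h1, h2, -⟩ := isFree_iff.1 h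
      calc f1 * nvars n + f2 < f1 * nvars n + nvars n := by simpa using h2
        _ = (f1 + 1) * nvars n := by ring
        _ ≤ nvars n * nvars n := Nat.mul_le_mul_right _ (by omega)
    · obtain ⟨f1, f2⟩ := f
      obtain ⟨-, h2, -⟩ := isFree_iff.1 h
      simp only [Prod.mk.injEq]
      constructor
      · rw [Nat.add_comm, Nat.add_mul_div_right _ _ hN, Nat.div_eq_of_lt h2, zero_add]
      · rw [Nat.add_comm, Nat.add_mul_mod_self_right, Nat.mod_eq_of_lt h2]

/-- The free list has no duplicates. [folklore] -/
private theorem nodup_freeList (n : ℕ) (b : List Bool) : (freeList n b).Nodup := by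
  have hN : 0 < nvars n := by unfold nvars; omega
  refine List.Nodup.filter _ (List.Nodup.map (fun s t hst => ?_) List.nodup_range)
  simp only [Prod.mk.injEq] at hst
  rw [← Nat.div_add_mod s (nvars n), ← Nat.div_add_mod t (nvars n), hst.1, hst.2]

/-- The indicator `[f = g]`. [folklore] -/
def δ (f g : ℕ × ℕ) : ℤ := if f = g then 1 else 0

/-- **Entry of the basis matrix `B_f`** at the sorted position `(lo, hi)`, `lo ≤ hi`: `[f = (lo, hi)]`,
plus, at a pivot position, the coefficient of `s_f` in the solved expression of that pivot
(`s_{x_v z} = s_{x_v x_v}`, `s_{y_v z} = s_{y_v y_v}`,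
`s_{x_v y_w} = s_{x_v x_v} + s_{y_v y_v} + s_{x_w x_w} + s_{y_w y_w} − s_{x_w y_v} − s_{zz}`); an
arithmetic expression in indicators (the machine's shape).
[cite: BlaserIkenmeyerLysikovPandeySchreyer2019, Thm. 34 (proof: basis of the kernel)] -/
def basisEntry (n : ℕ) (b : List Bool) (f : ℕ × ℕ) (lo hi : ℕ) : ℤ :=
  δ f (lo, hi) + (if hi = 2 * n ∧ lo < 2 * n then δ f (lo, lo) else 0) +
    (if lo < n ∧ n ≤ hi ∧ hi < 2 * n ∧ lo < hi - n ∧ b.getD (hi - n + n * lo) false = true then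
      δ f (lo, lo) + δ f (n + lo, n + lo) + δ f (hi - n, hi - n) + δ f (hi, hi) - δ f (hi - n, n + lo) -
        δ f (2 * n, 2 * n)
    else 0)

/-- **The basis matrix `B_f`** (symmetric by construction: the entry at `(a, c)` is the entry at the
sorted position). [cite: BlaserIkenmeyerLysikovPandeySchreyer2019, Thm. 34 (proof: basis of the kernel)] -/
def basisMat (n : ℕ) (b : List Bool) (f : ℕ × ℕ) : Matrix (Fin (nvars n)) (Fin (nvars n)) F :=
  fun a c => (basisEntry n b f (min a.1 c.1) (max a.1 c.1) : F)

/-- `B_f` is symmetric. [cite: BlaserIkenmeyerLysikovPandeySchreyer2019, Thm. 34 (proof)] -/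
theorem basisMat_apply_comm (n : ℕ) (b : List Bool) (f : ℕ × ℕ) (a c : Fin (nvars n)) :
    basisMat (F := F) n b f a c = basisMat n b f c a := by
  simp only [basisMat, min_comm, max_comm]

/-- Entries of `B_f` at a sorted position. [folklore] -/
private theorem entryAt_basisMat (n : ℕ) (b : List Bool) (f : ℕ × ℕ) {k l : ℕ} (hkl : k ≤ l)
    (hl : l < nvars n) : entryAt (basisMat (F := F) n b f) k l = (basisEntry n b f k l : F) := by
  simp [entryAt, basisMat, lt_of_le_of_lt hkl hl, hl, min_eq_left hkl, max_eq_right hkl]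

/-! #### Values of `basisEntry` -/

section BasisValues

variable {n : ℕ} {b : List Bool} {f : ℕ × ℕ}

/-- `δ f g = 0` when `f` is free and `g` is not. [folklore] -/
private theorem δ_eq_zero (hf : isFree n b f = true) {g : ℕ × ℕ} (hg : ¬ isFree n b g = true) : δ f g = 0 := by
  unfold δ
  rw [if_neg]
  rintro rfl
  exact hg hf

/-- At a free position, `B_g` has entry `[g = (lo, hi)]` (any `g`). [cite: BlaserIkenmeyerLysikovPandeySchreyer2019, Thm. 34 (proof)] -/
theorem basisEntry_free {lo hi : ℕ} (h : isFree n b (lo, hi) = true) (g : ℕ × ℕ) :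
    basisEntry n b g lo hi = δ g (lo, hi) := by
  obtain ⟨-, -, -, h4, h5⟩ := isFree_iff.1 h
  rw [basisEntry, if_neg h4, if_neg h5, add_zero, add_zero]

/-- At the pivot `x_v y_v`, `B_f = 0`. [cite: BlaserIkenmeyerLysikovPandeySchreyer2019, Thm. 34 (proof)] -/
theorem basisEntry_xy (hf : isFree n b f = true) {v : ℕ} (hv : v < n) : basisEntry n b f v (n + v) = 0 := by
  rw [basisEntry, if_neg (by omega), if_neg (by omega), add_zero, add_zero]
  exact δ_eq_zero hf fun h => (isFree_iff.1 h).2.2.1 ⟨hv, rfl⟩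

/-- At the pivots `x_v z`, `y_v z` (`lo < 2n`): `B_f = [f = (lo, lo)]`.
[cite: BlaserIkenmeyerLysikovPandeySchreyer2019, Thm. 34 (proof)] -/
theorem basisEntry_z (hf : isFree n b f = true) {lo : ℕ} (hlo : lo < 2 * n) :
    basisEntry n b f lo (2 * n) = δ f (lo, lo) := by
  rw [basisEntry, if_pos ⟨rfl, hlo⟩, if_neg (by omega), add_zero,
    δ_eq_zero hf fun h => (isFree_iff.1 h).2.2.2.1 ⟨rfl, hlo⟩, zero_add]

/-- At the edge pivot `x_v y_w` (`v < w`, bit `(v, w)` set): the solved expression.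
[cite: BlaserIkenmeyerLysikovPandeySchreyer2019, Thm. 34 (proof)] -/
theorem basisEntry_edge (hf : isFree n b f = true) {v w : ℕ} (hv : v < n) (hw : w < n) (hvw : v < w)
    (hbit : b.getD (w + n * v) false = true) :
    basisEntry n b f v (n + w) = δ f (v, v) + δ f (n + v, n + v) + δ f (w, w) + δ f (n + w, n + w) -
      δ f (w, n + v) - δ f (2 * n, 2 * n) := by
  have hc : v < n ∧ n ≤ n + w ∧ n + w < 2 * n ∧ v < n + w - n ∧ b.getD (n + w - n + n * v) false = true := by
    rw [Nat.add_sub_cancel_left]; exact ⟨hv, by omega, by omega, hvw, hbit⟩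
  rw [basisEntry, if_neg (by omega), if_pos hc, add_zero, Nat.add_sub_cancel_left,
    δ_eq_zero hf fun h => (isFree_iff.1 h).2.2.2.2 hc, zero_add]

/-- Diagonal positions are free. [folklore] -/
private theorem isFree_diag {i : ℕ} (hi : i < nvars n) : isFree n b (i, i) = true :=
  isFree_iff.2 ⟨le_rfl, hi, by omega, by omega, by omega⟩

/-- The back edge position `x_w y_v` (`v < w`) is free. [folklore] -/
private theorem isFree_back {v w : ℕ} (hw : w < n) (hvw : v < w) : isFree n b (w, n + v) = true :=
  isFree_iff.2 ⟨by omega, by unfold nvars; omega, by omega, by omega, by omega⟩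

end BasisValues

/-- **Every `B_f` (`f` free) lies in the kernel** (solved-form check).
[cite: BlaserIkenmeyerLysikovPandeySchreyer2019, Thm. 34 (proof: basis of the kernel)] -/
theorem kerRel_basisMat {n : ℕ} (b : List Bool) (G : SimpleGraph (Fin n))
    (hb : ∀ u w : Fin n, b.getD (w + n * u) false = true ↔ G.Adj u w) {f : ℕ × ℕ}
    (hf : isFree n b f = true) : KerRel G (basisMat (F := F) n b f) := by
  have hN : ∀ {v : ℕ}, v < n → v < nvars n ∧ n + v < nvars n ∧ 2 * n < nvars n := fun hv => by
    unfold nvars; omega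
  refine ⟨fun v => ⟨?_, ?_, ?_⟩, fun v w hvw => ?_⟩
  · rw [entryAt_basisMat (F := F) n b f (by omega) (hN v.2).2.1, basisEntry_xy hf v.2, Int.cast_zero]
  · rw [entryAt_basisMat (F := F) n b f le_rfl (hN v.2).1, entryAt_basisMat (F := F) n b f (by omega) (hN v.2).2.2,
      basisEntry_free (isFree_diag (hN v.2).1), basisEntry_z hf (by omega), sub_self]
  · rw [entryAt_basisMat (F := F) n b f le_rfl (hN v.2).2.1,
      entryAt_basisMat (F := F) n b f (by omega) (hN v.2).2.2,
      basisEntry_free (isFree_diag (hN v.2).2.1), basisEntry_z hf (by omega), sub_self]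
  · wlog hlt : (v : ℕ) < w generalizing v w
    · have hne : (v : ℕ) ≠ w := fun e => G.irrefl (by rwa [show w = v from (Fin.ext e).symm] at hvw)
      have := this w v hvw.symm (by omega)
      rw [← this]; ring
    have hbit : b.getD (w + n * v) false = true := (hb v w).2 hvw
    rw [entryAt_basisMat (F := F) n b f le_rfl (hN v.2).1, entryAt_basisMat (F := F) n b f le_rfl (hN v.2).2.1,
      entryAt_basisMat (F := F) n b f le_rfl (hN w.2).1, entryAt_basisMat (F := F) n b f le_rfl (hN w.2).2.1,
      entryAt_basisMat (F := F) n b f (by omega) (hN w.2).2.1,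
      entryAt_basisMat (F := F) n b f (by omega) (hN v.2).2.1,
      entryAt_basisMat (F := F) n b f le_rfl (hN v.2).2.2,
      basisEntry_free (isFree_diag (hN v.2).1), basisEntry_free (isFree_diag (hN v.2).2.1),
      basisEntry_free (isFree_diag (hN w.2).1), basisEntry_free (isFree_diag (hN w.2).2.1),
      basisEntry_edge hf v.2 w.2 hlt hbit, basisEntry_free (isFree_back w.2 hlt),
      basisEntry_free (isFree_diag (hN v.2).2.2)]
    push_cast
    ring

/-- `B_f` (`f` free) is annihilated by every form of the instance.
[cite: BlaserIkenmeyerLysikovPandeySchreyer2019, Thm. 34 (proof: basis of the kernel)] -/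
theorem inKer_basisMat {n : ℕ} (b : List Bool) (G : SimpleGraph (Fin n))
    (hb : ∀ u w : Fin n, b.getD (w + n * u) false = true ↔ G.Adj u w) {f : ℕ × ℕ}
    (hf : isFree n b f = true) : InKer n b (basisMat (F := F) n b f) :=
  (inKer_iff_kerRel b G hb _).2 (kerRel_basisMat b G hb hf)

/-- Symmetric entries. [folklore] -/
private theorem entryAt_comm {N : ℕ} {S : Matrix (Fin N) (Fin N) F} (hS : S.IsSymm) (k l : ℕ) :
    entryAt S k l = entryAt S l k := by
  unfold entryAt
  by_cases hk : k < N
  · by_cases hl : l < N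
    · rw [dif_pos ⟨hk, hl⟩, dif_pos ⟨hl, hk⟩]
      exact hS.apply ⟨l, hl⟩ ⟨k, hk⟩
    · rw [dif_neg fun h => hl h.2, dif_neg fun h => hl h.1]
  · rw [dif_neg fun h => hk h.1, dif_neg fun h => hk h.2]

/-- Sums against an indicator. [folklore] -/
private theorem sum_mul_δ (s : Finset (ℕ × ℕ)) (c : ℕ × ℕ → F) (g : ℕ × ℕ) :
    ∑ f ∈ s, c f * ((δ f g : ℤ) : F) = if g ∈ s then c g else 0 := by
  simp only [δ, Int.cast_ite, Int.cast_one, Int.cast_zero, mul_ite, mul_one, mul_zero]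
  exact Finset.sum_ite_eq' s g c

/-- **Kernel elements are spanned by the `B_f`** (coordinates: the free entries).
[cite: BlaserIkenmeyerLysikovPandeySchreyer2019, Thm. 34 (proof: basis of the kernel)] -/
theorem entryAt_eq_sum_basisEntry {n : ℕ} (b : List Bool) (G : SimpleGraph (Fin n))
    (hb : ∀ u w : Fin n, b.getD (w + n * u) false = true ↔ G.Adj u w)
    {S : Matrix (Fin (nvars n)) (Fin (nvars n)) F} (hS : S.IsSymm) (hK : KerRel G S)
    {k l : ℕ} (hk : k < nvars n) (hl : l < nvars n) :
    entryAt S k l = ∑ f ∈ (freeList n b).toFinset,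
      entryAt S f.1 f.2 * (basisEntry n b f (min k l) (max k l) : F) := by
  classical
  -- reduce to a sorted position `lo ≤ hi`
  wlog hkl : k ≤ l generalizing k l
  · rw [entryAt_comm hS, this hl hk (by omega), min_comm, max_comm]
  rw [min_eq_left hkl, max_eq_right hkl]
  have memF : ∀ {g : ℕ × ℕ}, isFree n b g = true → g ∈ (freeList n b).toFinset := fun hg =>
    List.mem_toFinset.2 (mem_freeList_iff.2 hg)
  have hfree : ∀ f ∈ (freeList n b).toFinset, isFree n b f = true := fun f hf =>
    mem_freeList_iff.1 (List.mem_toFinset.1 hf)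
  by_cases hfr : isFree n b (k, l) = true
  · -- a free position: only `B_{(k,l)}` contributes
    rw [Finset.sum_congr rfl fun f hf => by rw [basisEntry_free hfr], sum_mul_δ, if_pos (memF hfr)]
  · -- a pivot position: the solved relation
    have hpiv : (k < n ∧ l = n + k) ∨ (l = 2 * n ∧ k < 2 * n) ∨
        (k < n ∧ n ≤ l ∧ l < 2 * n ∧ k < l - n ∧ b.getD (l - n + n * k) false = true) := by
      by_contra hcon
      exact hfr (isFree_iff.2 ⟨hkl, hl, fun h => hcon (Or.inl h), fun h => hcon (Or.inr (Or.inl h)),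
        fun h => hcon (Or.inr (Or.inr h))⟩)
    rcases hpiv with ⟨hkn, rfl⟩ | ⟨rfl, hk2⟩ | ⟨hkn, hnl, hl2, hkl', hbit⟩
    · -- `x_v y_v`
      rw [Finset.sum_congr rfl fun f hf => by rw [basisEntry_xy (hfree f hf) hkn], Int.cast_zero]
      simp only [mul_zero, Finset.sum_const_zero]
      exact (hK.1 ⟨k, hkn⟩).1
    · -- `x_v z` / `y_v z`
      rw [Finset.sum_congr rfl fun f hf => by rw [basisEntry_z (hfree f hf) hk2], sum_mul_δ,
        if_pos (memF (isFree_diag hk))]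
      by_cases hkn : k < n
      · exact (sub_eq_zero.1 (hK.1 ⟨k, hkn⟩).2.1).symm
      · obtain ⟨v, rfl⟩ : ∃ v, k = n + v := ⟨k - n, by omega⟩
        exact (sub_eq_zero.1 (hK.1 ⟨v, by omega⟩).2.2).symm
    · -- `x_v y_w`, `v < w`, an edge
      obtain ⟨w, rfl⟩ : ∃ w, l = n + w := ⟨l - n, by omega⟩
      rw [Nat.add_sub_cancel_left] at hkl' hbit
      have hw : w < n := by omega
      have hadj : G.Adj ⟨k, hkn⟩ ⟨w, hw⟩ := (hb ⟨k, hkn⟩ ⟨w, hw⟩).1 hbit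
      have hN : k < nvars n ∧ n + k < nvars n ∧ w < nvars n ∧ n + w < nvars n ∧ 2 * n < nvars n := by
        unfold nvars; omega
      rw [Finset.sum_congr rfl fun f hf => by rw [basisEntry_edge (hfree f hf) hkn hw hkl' hbit]]
      simp only [Int.cast_add, Int.cast_sub, mul_add, mul_sub, Finset.sum_add_distrib,
        Finset.sum_sub_distrib, sum_mul_δ, if_pos (memF (isFree_diag hN.1)),
        if_pos (memF (isFree_diag hN.2.1)), if_pos (memF (isFree_diag hN.2.2.1)),
        if_pos (memF (isFree_diag hN.2.2.2.1)), if_pos (memF (isFree_diag hN.2.2.2.2)),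
        if_pos (memF (isFree_back hw hkl'))]
      have h := hK.2 ⟨k, hkn⟩ ⟨w, hw⟩ hadj
      simp only at h
      linear_combination -h

/-- **The `B_f` are independent**: the free entry `f` of `Σ y_g B_g` is `y_f`.
[cite: BlaserIkenmeyerLysikovPandeySchreyer2019, Thm. 34 (proof: basis of the kernel)] -/
theorem sum_mul_basisEntry_free {n : ℕ} (b : List Bool) (y : ℕ × ℕ → F) {f : ℕ × ℕ}
    (hf : isFree n b f = true) :
    ∑ g ∈ (freeList n b).toFinset, y g * (basisEntry n b g f.1 f.2 : F) = y f := by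
  classical
  rw [Finset.sum_congr rfl fun g _ => by rw [basisEntry_free (lo := f.1) (hi := f.2) hf], sum_mul_δ,
    if_pos (List.mem_toFinset.2 (mem_freeList_iff.2 hf))]

end Kernel

/-! ### §E. The `HMinRank1` instance of a graph code and the printed equivalence -/

section Instance

/-- The slice `B_f` as a row-major list. [cite: BlaserIkenmeyerLysikovPandeySchreyer2019, Thm. 34 (proof: "`T = Σ e_i ⊗ A_i`")] -/
def rowOf (n : ℕ) (b : List Bool) (f : ℕ × ℕ) : List ℤ :=
  (List.range (nvars n * nvars n)).map fun t =>
    basisEntry n b f (min (t / nvars n) (t % nvars n)) (max (t / nvars n) (t % nvars n))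

/-- The entries of the tensor `T = Σ_f e_f ⊗ B_f`, slices in the order of the free list.
[cite: BlaserIkenmeyerLysikovPandeySchreyer2019, Thm. 34 (proof)] -/
def entriesOf (n : ℕ) (b : List Bool) : List ℤ := ((freeList n b).map (rowOf n b)).flatten

/-- **The `HMinRank1` instance of `(n, bits)`**: `(2n+1, #free, entries of T, r = 1)`.
[cite: BlaserIkenmeyerLysikovPandeySchreyer2019, Thm. 34 (proof)] -/
def inst1Of (n : ℕ) (b : List Bool) : ℕ × ℕ × List ℤ × ℕ :=
  (nvars n, (freeList n b).length, entriesOf n b, 1)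

/-- The fixed non-member `(0, 0, [], 0)` (its `r` is `0 ≠ 1`). [cite: BlaserIkenmeyerLysikovPandeySchreyer2019, Problem 3] -/
def bad1 : ℕ × ℕ × List ℤ × ℕ := (0, 0, [], 0)

/-- A slice row has `N²` entries. [folklore] -/
private theorem length_rowOf (n : ℕ) (b : List Bool) (f : ℕ × ℕ) : (rowOf n b f).length = nvars n * nvars n := by
  simp [rowOf]

/-- The entry list has `#free · N²` entries. [folklore] -/
private theorem length_entriesOf (n : ℕ) (b : List Bool) :
    (entriesOf n b).length = (freeList n b).length * nvars n ^ 2 := by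
  simp [entriesOf, List.length_flatten, List.map_map, Function.comp_def, length_rowOf, List.map_const',
    List.sum_replicate, sq]

/-- Indexing a flattened list of blocks of equal length. [folklore] -/
private theorem getD_flatten_of_length_eq {m : ℕ} {d : ℤ} :
    ∀ (L : List (List ℤ)), (∀ l ∈ L, l.length = m) → ∀ (a r : ℕ), r < m →
      L.flatten.getD (a * m + r) d = (L.getD a []).getD r d
  | [], _, a, r, _ => by simp
  | l :: L, hL, 0, r, hr => by
    have hl : l.length = m := hL l List.mem_cons_self
    rw [List.flatten_cons, zero_mul, zero_add, List.getD_append _ _ _ _ (by omega)]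
    simp
  | l :: L, hL, a + 1, r, hr => by
    have hl : l.length = m := hL l List.mem_cons_self
    rw [List.flatten_cons, List.getD_append_right _ _ _ _ (by rw [hl]; nlinarith),
      show (a + 1) * m + r - l.length = a * m + r by rw [hl]; ring_nf; omega]
    rw [getD_flatten_of_length_eq L (fun l' hl' => hL l' (List.mem_cons_of_mem _ hl')) a r hr]
    simp

/-- Reading an entry of a slice back from its row. [folklore] -/
private theorem getD_rowOf (n : ℕ) (b : List Bool) (f : ℕ × ℕ) (i j : Fin (nvars n)) :
    (rowOf n b f).getD (i.1 * nvars n + j.1) 0 = basisEntry n b f (min i.1 j.1) (max i.1 j.1) := by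
  have hlt : i.1 * nvars n + j.1 < nvars n * nvars n := by
    calc i.1 * nvars n + j.1 < i.1 * nvars n + nvars n := by have := j.2; omega
      _ = (i.1 + 1) * nvars n := by ring
      _ ≤ nvars n * nvars n := Nat.mul_le_mul_right _ (by have := i.2; omega)
  rw [rowOf, List.getD_eq_getElem _ _ (by rw [List.length_map, List.length_range]; exact hlt),
    List.getElem_map, List.getElem_range]
  have hN : 0 < nvars n := by unfold nvars; omega
  have h1 : (i.1 * nvars n + j.1) / nvars n = i.1 := by
    rw [Nat.add_comm, Nat.add_mul_div_right _ _ hN, Nat.div_eq_of_lt j.2, zero_add]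
  have h2 : (i.1 * nvars n + j.1) % nvars n = j.1 := by
    rw [Nat.add_comm, Nat.add_mul_mod_self_right, Nat.mod_eq_of_lt j.2]
  rw [h1, h2]

variable (F : Type u) [Field F]

/-- **The tensor of the instance is `T = Σ_f e_f ⊗ B_f`.** [cite: BlaserIkenmeyerLysikovPandeySchreyer2019, Thm. 34 (proof)] -/
theorem hmrTensorOfList_entriesOf (n : ℕ) (b : List Bool) :
    hmrTensorOfList F (nvars n) (freeList n b).length (entriesOf n b) =
      fun a => basisMat n b ((freeList n b)[a.1]) := by
  funext a i j
  unfold hmrTensorOfList basisMat entriesOf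
  rw [show a.1 * nvars n ^ 2 + i.1 * nvars n + j.1 = a.1 * (nvars n * nvars n) + (i.1 * nvars n + j.1) by ring,
    getD_flatten_of_length_eq _ (fun l hl => by
      obtain ⟨f, -, rfl⟩ := List.mem_map.1 hl
      exact length_rowOf n b f) _ _ (by
      calc i.1 * nvars n + j.1 < i.1 * nvars n + nvars n := by have := j.2; omega
        _ = (i.1 + 1) * nvars n := by ring
        _ ≤ nvars n * nvars n := Nat.mul_le_mul_right _ (by have := i.2; omega)),
    List.getD_eq_getElem ((freeList n b).map (rowOf n b)) [] (by rw [List.length_map]; exact a.2),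
    List.getElem_map, getD_rowOf]

/-- The yes-instances of `HMinRank1_{{0,1,−1},F}` (the set whose codes form `hmr1Language F`).
[cite: BlaserIkenmeyerLysikovPandeySchreyer2019, Problem 3] -/
def hmr1Set : Set (ℕ × ℕ × List ℤ × ℕ) :=
  {x | HMRWellFormed x ∧ x.2.2.2 = 1 ∧
    hmrTensorOfList F x.1 x.2.1 x.2.2.1 ∈ (minrankSet F 1 : Set (Fin x.2.1 → Fin x.1 → Fin x.1 → F))}

/-- `hmr1Language F` is the language of codes of `hmr1Set F` (definitional).
[cite: BlaserIkenmeyerLysikovPandeySchreyer2019, Problem 3] -/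
theorem hmr1Language_eq : hmr1Language F = tensorInstEncoding.toLanguage (hmr1Set F) := rfl

/-- The fixed non-member is a non-member. [cite: BlaserIkenmeyerLysikovPandeySchreyer2019, Problem 3] -/
theorem bad1_not_mem : bad1 ∉ hmr1Set F := fun h => zero_ne_one h.2.1

variable {F}

/-- Entries at `Fin` indices. [folklore] -/
private theorem entryAt_fin {N : ℕ} (S : Matrix (Fin N) (Fin N) F) (i j : Fin N) : entryAt S i.1 j.1 = S i j := by
  simp [entryAt, i.2, j.2]

/-- The contraction `T y` of the instance tensor is `Σ_a y_a B_{f_a}`. [cite: BlaserIkenmeyerLysikovPandeySchreyer2019, Thm. 34 (proof)] -/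
private theorem contract3_apply (n : ℕ) (b : List Bool) (y : Fin (freeList n b).length → F)
    (i j : Fin (nvars n)) :
    contract3 (fun a : Fin (freeList n b).length => basisMat (F := F) n b ((freeList n b)[a.1])) y i j =
      ∑ a : Fin (freeList n b).length, y a * (basisEntry n b ((freeList n b)[a.1]) (min i.1 j.1) (max i.1 j.1) : F) :=
  rfl

variable (F)

/-- **The printed equivalence (Thm 34 on the Thm-33 instances): the `HMinRank1` instance of a graph
code is a yes-instance iff the graph is 3-colourable** — "nontrivial common zeroes `x` of [the forms]
correspond to rank `1` symmetric matrices `x ⊗ x` [in the kernel] … a contraction `Ty` with nonzero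
`y`", composed with Thm 33's equivalence. [cite: BlaserIkenmeyerLysikovPandeySchreyer2019, Thm. 34 (proof), Thm. 33 (proof)] -/
theorem inst1Of_mem_iff {n : ℕ} (b : List Bool) (G : SimpleGraph (Fin n))
    (hb : ∀ u w : Fin n, b.getD (w + n * u) false = true ↔ G.Adj u w) :
    inst1Of n b ∈ hmr1Set F ↔ G.Colorable 3 := by
  classical
  rw [← exists_isSolution_iff (F := F) G, ← exists_common_zero_iff b G hb]
  have hwf : HMRWellFormed (inst1Of n b) := by
    unfold HMRWellFormed inst1Of
    exact length_entriesOf n b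
  simp only [hmr1Set, Set.mem_setOf_eq, hwf, true_and]
  unfold inst1Of
  simp only [true_and]
  rw [hmrTensorOfList_entriesOf]
  unfold minrankSet
  simp only [Set.mem_setOf_eq]
  have hfree : ∀ a : Fin (freeList n b).length, isFree n b ((freeList n b)[a.1]) = true := fun a =>
    mem_freeList_iff.1 (List.getElem_mem a.2)
  constructor
  · rintro ⟨y, hy, hrank⟩
    -- `M = T y = Σ y_a B_{f_a}`: symmetric, in the kernel, nonzero
    have hsym : ∀ i j, contract3 (fun a : Fin (freeList n b).length => basisMat (F := F) n b
        ((freeList n b)[a.1])) y i j = contract3 (fun a : Fin (freeList n b).length =>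
        basisMat (F := F) n b ((freeList n b)[a.1])) y j i := fun i j => by
      rw [contract3_apply, contract3_apply, min_comm, max_comm]
    have hker : ∀ q < 3 * n + n * n, pairForm (formOf n b q) (contract3 (fun a : Fin (freeList n b).length =>
        basisMat (F := F) n b ((freeList n b)[a.1])) y) = 0 := by
      intro q hq
      have he : contract3 (fun a : Fin (freeList n b).length => basisMat (F := F) n b ((freeList n b)[a.1])) y =
          ∑ a, y a • basisMat (F := F) n b ((freeList n b)[a.1]) := by
        ext i j
        simp only [contract3, Matrix.sum_apply, Matrix.smul_apply, smul_eq_mul]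
      rw [he, pairForm_sum]
      refine Finset.sum_eq_zero fun a _ => ?_
      rw [pairForm_smul, inKer_basisMat b G hb (hfree a) q hq, mul_zero]
    have hne : ∃ i j, contract3 (fun a : Fin (freeList n b).length => basisMat (F := F) n b
        ((freeList n b)[a.1])) y i j ≠ 0 := by
      by_contra h0
      push Not at h0
      apply hy
      funext a₀
      have hf0 : isFree n b (((freeList n b)[a₀.1]).1, ((freeList n b)[a₀.1]).2) = true := hfree a₀
      obtain ⟨h1, h2, -⟩ := isFree_iff.1 hf0
      have h := h0 ⟨_, lt_of_le_of_lt h1 h2⟩ ⟨_, h2⟩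
      rw [contract3_apply] at h
      simp only [min_eq_left h1, max_eq_right h1, basisEntry_free hf0] at h
      rw [Finset.sum_eq_single a₀ (fun a _ ha => by
          have hne' : (freeList n b)[a.1] ≠ (((freeList n b)[a₀.1]).1, ((freeList n b)[a₀.1]).2) := fun e =>
            ha (Fin.ext ((nodup_freeList n b).getElem_inj_iff.1 e))
          simp [δ, hne']) (fun h => absurd (Finset.mem_univ _) h)] at h
      simpa [δ] using h
    -- rank one and symmetric: `M = λ • c cᵀ`
    obtain ⟨c, r, hcr⟩ := exists_vecMulVec_of_rank_le_one _ hrank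
    obtain ⟨i₀, j₀, hij⟩ := hne
    rw [hcr, vecMulVec_apply] at hij
    have hc : c i₀ ≠ 0 := left_ne_zero_of_mul hij
    have hr : r j₀ ≠ 0 := right_ne_zero_of_mul hij
    have hrj : ∀ j, r j = r i₀ / c i₀ * c j := fun j => by
      have h := hsym i₀ j
      rw [hcr, vecMulVec_apply, vecMulVec_apply] at h
      field_simp
      linear_combination h
    have hl : r i₀ / c i₀ ≠ 0 := fun h0 => hr (by rw [hrj, h0, zero_mul])
    have hvv : vecMulVec c r = (r i₀ / c i₀) • vecMulVec c c := by
      ext i j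
      simp only [vecMulVec_apply, Matrix.smul_apply, smul_eq_mul, hrj j]
      ring
    refine ⟨c, fun h0 => hc (by rw [h0]; rfl), fun q hq => ?_⟩
    have h := hker q hq
    rw [hcr, hvv, pairForm_smul, ← quadFormOfList_eq_pairForm] at h
    exact (mul_eq_zero.1 h).resolve_left hl
  · rintro ⟨v, hv, hq⟩
    -- `S = v vᵀ` is a symmetric kernel element; its free entries are the certificate `y`
    have hS : (vecMulVec v v).IsSymm := transpose_vecMulVec v v
    have hK : KerRel G (vecMulVec v v) := (inKer_iff_kerRel b G hb _).1 fun q hq' => by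
      rw [← quadFormOfList_eq_pairForm]; exact hq q hq'
    refine ⟨fun a => entryAt (vecMulVec v v) ((freeList n b)[a.1]).1 ((freeList n b)[a.1]).2, ?_, ?_⟩
    · obtain ⟨i, hi⟩ : ∃ i, v i ≠ 0 := by
        by_contra h0
        push Not at h0
        exact hv (funext h0)
      obtain ⟨a, ha, hfa⟩ := List.mem_iff_getElem.1 (mem_freeList_iff.2 (isFree_diag (b := b) i.2))
      intro h0
      have h := congr_fun h0 ⟨a, ha⟩
      simp only [Pi.zero_apply, hfa, entryAt_fin, vecMulVec_apply] at h
      exact hi (mul_self_eq_zero.1 h)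
    · have hc : contract3 (fun a : Fin (freeList n b).length => basisMat (F := F) n b ((freeList n b)[a.1]))
          (fun a => entryAt (vecMulVec v v) ((freeList n b)[a.1]).1 ((freeList n b)[a.1]).2) = vecMulVec v v := by
        ext i j
        rw [contract3_apply, ← entryAt_fin (vecMulVec v v) i j, entryAt_eq_sum_basisEntry b G hb hS hK i.2 j.2,
          List.sum_toFinset _ (nodup_freeList n b)]
        exact Fin.sum_univ_fun_getElem (freeList n b) fun f =>
          entryAt (vecMulVec v v) f.1 f.2 * (basisEntry n b f (min i.1 j.1) (max i.1 j.1) : F)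
      rw [hc]
      exact rank_vecMulVec_le v v

end Instance

/-! ### §M. The machine: the instance map on codes, in the typed `CodeFP` algebra -/

section Machine

open CodeFP Brick

/-- The code of an `HMinRank` instance `(N, k, entries, r)`: `tensorInstEncoding`, i.e. two binary
numerals, a headed list of sign–magnitude integers, a binary numeral.
[cite: BlaserIkenmeyerLysikovPandeySchreyer2019, Problem 3 (input)] -/
def instE : ℕ × ℕ × List ℤ × ℕ → List Bool := pairE natE (pairE natE (pairE (listE smE) natE))

/-- `instE` is `tensorInstEncoding.encode`. [cite: AroraBarak2009, §0.1 (codes of pairs and lists)] -/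
theorem instE_eq : (tensorInstEncoding.encode : ℕ × ℕ × List ℤ × ℕ → List Bool) = instE := by
  unfold instE tensorInstEncoding smE
  rw [pairE_eq, pairE_eq, pairE_eq, listE_eq, natE_eq]

/-- **The killing-slot test** at slot `q = w + n u`: bit `(u, w)` set with `u = w` or bit `(w, u)`
unset (the bit matrix is not the adjacency matrix of a graph there; Thm 33's form `z²`).
[cite: BlaserIkenmeyerLysikovPandeySchreyer2019, Thm. 33 (proof)] -/
def killAt (n : ℕ) (b : List Bool) (q : ℕ) : Bool :=
  b.getD q false && (decide (q / n = q % n) || !b.getD (q / n + n * (q % n)) false)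

/-- **The code test**: a graph-shaped code (`BILPS19HQuad.isGCode`) none of whose first
`min (n², budget)` slots is killing. [cite: AroraBarak2009, §0.1 (adjacency-matrix representation)] -/
def guard1 (w : List Bool) : Bool :=
  isGCode w && (List.range (min ((hdrOf w).1 * (hdrOf w).1) (List.replicate (budget (hdrOf w).2) ()).length)).all
    fun q => !killAt (hdrOf w).1 (hdrOf w).2 q

/-- **The instance map on all strings**: guarded codes go to the instance of their header,
everything else to the fixed non-member. [cite: BlaserIkenmeyerLysikovPandeySchreyer2019, Cor. 35 (proof = Thm 33 + Thm 34)] -/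
def reduce1 (w : List Bool) : ℕ × ℕ × List ℤ × ℕ :=
  if guard1 w then inst1Of (hdrOf w).1 (hdrOf w).2 else bad1

/-- The bounded range of positions / slots. [cite: AroraBarak2009, §1.3 (polynomially bounded loops)] -/
def posRange (p : ℕ × List Bool) : List ℕ :=
  List.range (min (nvars p.1 * nvars p.1) (List.replicate (budget p.2) ()).length)

/-- The free list tabulated under the budget. [cite: AroraBarak2009, §1.3] -/
def freeListCapped (p : ℕ × List Bool) : List (ℕ × ℕ) :=
  ((posRange p).map fun t => (t / nvars p.1, t % nvars p.1)).filter (isFree p.1 p.2)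

/-- A slice tabulated under the budget. [cite: AroraBarak2009, §1.3] -/
def rowCapped (p : ℕ × List Bool) (f : ℕ × ℕ) : List ℤ :=
  (posRange p).map fun t =>
    basisEntry p.1 p.2 f (min (t / nvars p.1) (t % nvars p.1)) (max (t / nvars p.1) (t % nvars p.1))

/-- The instance tabulated under the budget (equal to `inst1Of` on graph-shaped codes).
[cite: AroraBarak2009, §1.3] -/
def inst1Capped (p : ℕ × List Bool) : ℕ × ℕ × List ℤ × ℕ :=
  (nvars p.1, (freeListCapped p).length, ((freeListCapped p).map (rowCapped p)).flatten, 1)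

/-- The budget dominates both loop bounds when `|bits| = n²`. [folklore] -/
private theorem bounds_le_budget' {n : ℕ} {b : List Bool} (h : b.length = n * n) :
    n * n ≤ budget b ∧ nvars n * nvars n ≤ budget b := by
  unfold budget nvars
  rw [h]
  have hexp : (n * n + 2) ^ 3 = (n * n) ^ 3 + 6 * (n * n) ^ 2 + 12 * (n * n) + 8 := by ring
  have h2 : (2 * n + 1) * (2 * n + 1) = 4 * (n * n) + 4 * n + 1 := by ring
  rw [hexp, h2]
  have hm : n ≤ n * n := Nat.le_mul_self n
  constructor <;> nlinarith [Nat.zero_le ((n * n) ^ 3), Nat.zero_le ((n * n) ^ 2)]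

/-- On graph-shaped codes the bounded range is the range. [folklore] -/
private theorem posRange_eq {p : ℕ × List Bool} (h : p.2.length = p.1 * p.1) :
    posRange p = List.range (nvars p.1 * nvars p.1) := by
  rw [posRange, List.length_replicate, min_eq_left (bounds_le_budget' h).2]

/-- On graph-shaped codes the capped tables are the tables. [folklore] -/
private theorem inst1Capped_eq {p : ℕ × List Bool} (h : p.2.length = p.1 * p.1) :
    inst1Capped p = inst1Of p.1 p.2 := by
  have hfl : freeListCapped p = freeList p.1 p.2 := by rw [freeListCapped, posRange_eq h, freeList]
  have hrow : rowCapped p = rowOf p.1 p.2 := by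
    funext f
    rw [rowCapped, posRange_eq h, rowOf]
  rw [inst1Capped, hfl, hrow, inst1Of, entriesOf]

/-- The indicator, machine shape. [folklore] -/
def δB (f g : ℕ × ℕ) : ℤ := if decide (f.1 = g.1) && decide (f.2 = g.2) then 1 else 0

/-- The machine indicator is the indicator. [folklore] -/
private theorem δB_eq (f g : ℕ × ℕ) : δB f g = δ f g := by
  obtain ⟨f1, f2⟩ := f
  obtain ⟨g1, g2⟩ := g
  simp only [δB, δ, Bool.and_eq_true, decide_eq_true_eq, Prod.mk.injEq]

/-- The basis entry, machine shape (Boolean tests). [folklore] -/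
def basisEntryB (n : ℕ) (b : List Bool) (f : ℕ × ℕ) (lo hi : ℕ) : ℤ :=
  δB f (lo, hi) + (if decide (hi = 2 * n) && decide (lo < 2 * n) then δB f (lo, lo) else 0) +
    (if decide (lo < n) && decide (n ≤ hi) && decide (hi < 2 * n) && decide (lo < hi - n) &&
        b.getD (hi - n + n * lo) false then
      δB f (lo, lo) + δB f (n + lo, n + lo) + δB f (hi - n, hi - n) + δB f (hi, hi) - δB f (hi - n, n + lo) -
        δB f (2 * n, 2 * n)
    else 0)

/-- The machine entry is the entry. [folklore] -/
private theorem basisEntryB_eq (n : ℕ) (b : List Bool) (f : ℕ × ℕ) (lo hi : ℕ) :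
    basisEntryB n b f lo hi = basisEntry n b f lo hi := by
  simp only [basisEntryB, basisEntry, δB_eq, Bool.and_eq_true, decide_eq_true_eq, and_assoc]

/-- The context of an entry: `(((n, bits), f), t)` — header, free coordinate, position.
[cite: AroraBarak2009, §1.3] -/
abbrev ectxE : ((ℕ × List Bool) × (ℕ × ℕ)) × ℕ → List Bool := pairE (pairE (pairE natE strE) (pairE natE natE)) natE

/-- **The basis entry on codes.** [cite: BlaserIkenmeyerLysikovPandeySchreyer2019, Thm. 34 (proof)] [cite: AroraBarak2009, §1.3] -/
theorem basisEntryFP : CodeFP ectxE smE (fun c => basisEntry c.1.1.1 c.1.1.2 c.1.2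
    (min (c.2 / nvars c.1.1.1) (c.2 % nvars c.1.1.1)) (max (c.2 / nvars c.1.1.1) (c.2 % nvars c.1.1.1))) := by
  have hn : CodeFP ectxE natE (fun c => c.1.1.1) := (fst _ _).fst'.fst'
  have hb : CodeFP ectxE strE (fun c => c.1.1.2) := (fst _ _).fst'.snd'
  have hf1 : CodeFP ectxE natE (fun c => c.1.2.1) := (fst _ _).snd'.fst'
  have hf2 : CodeFP ectxE natE (fun c => c.1.2.2) := (fst _ _).snd'.snd'
  have ht : CodeFP ectxE natE (fun c => c.2) := snd _ _
  have hN : CodeFP ectxE natE (fun c => nvars c.1.1.1) :=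
    (natAdd.comp ((natMul.comp ((const _ 2).pair hn)).pair (const _ 1))).congr fun _ => rfl
  have hi : CodeFP ectxE natE (fun c => c.2 / nvars c.1.1.1) := (natDiv.comp (ht.pair hN)).congr fun _ => rfl
  have hj : CodeFP ectxE natE (fun c => c.2 % nvars c.1.1.1) := (natMod.comp (ht.pair hN)).congr fun _ => rfl
  have hlo : CodeFP ectxE natE (fun c => min (c.2 / nvars c.1.1.1) (c.2 % nvars c.1.1.1)) :=
    (natMin.comp (hi.pair hj)).congr fun _ => rfl
  have hhi : CodeFP ectxE natE (fun c => max (c.2 / nvars c.1.1.1) (c.2 % nvars c.1.1.1)) :=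
    (natMax.comp (hi.pair hj)).congr fun _ => rfl
  have h2n : CodeFP ectxE natE (fun c => 2 * c.1.1.1) := (natMul.comp ((const _ 2).pair hn)).congr fun _ => rfl
  have hnlo : CodeFP ectxE natE (fun c => c.1.1.1 + min (c.2 / nvars c.1.1.1) (c.2 % nvars c.1.1.1)) :=
    (natAdd.comp (hn.pair hlo)).congr fun _ => rfl
  have hhin : CodeFP ectxE natE (fun c => max (c.2 / nvars c.1.1.1) (c.2 % nvars c.1.1.1) - c.1.1.1) :=
    (natSub.comp (hhi.pair hn)).congr fun _ => rfl
  -- indicators `δB f (a, c)`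
  have ind : ∀ {ga gb : ((ℕ × List Bool) × (ℕ × ℕ)) × ℕ → ℕ}, CodeFP ectxE natE ga → CodeFP ectxE natE gb →
      CodeFP ectxE intE (fun c => δB c.1.2 (ga c, gb c)) := fun hga hgb =>
    (((natEq.comp (hf1.pair hga)).and (natEq.comp (hf2.pair hgb))).ite (const _ (1 : ℤ)) (const _ (0 : ℤ))).congr
      fun _ => rfl
  have c0 : CodeFP ectxE intE (fun _ => (0 : ℤ)) := const _ _
  have T2 := ((natEq.comp (hhi.pair h2n)).and (natLt.comp (hlo.pair h2n))).ite (ind hlo hlo) c0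
  have cond3 := ((((natLt.comp (hlo.pair hn)).and (natLe.comp (hn.pair hhi))).and (natLt.comp (hhi.pair h2n))).and
    (natLt.comp (hlo.pair hhin))).and (strGetDNat.comp (hb.pair (natAdd.comp (hhin.pair (natMul.comp (hn.pair hlo))))))
  have S3 := intSub.comp ((intSub.comp ((intAdd.comp ((intAdd.comp ((intAdd.comp ((ind hlo hlo).pair
    (ind hnlo hnlo))).pair (ind hhin hhin))).pair (ind hhi hhi))).pair (ind hhin hnlo))).pair (ind h2n h2n))
  have T3 := cond3.ite S3 c0
  have total := intAdd.comp ((intAdd.comp ((ind hlo hhi).pair T2)).pair T3)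
  refine ((smOfInt.comp total).congr fun c => ?_)
  rw [← basisEntryB_eq]
  rfl

/-- The bounded range of positions on codes. [cite: AroraBarak2009, §1.3] -/
theorem posRangeFP : CodeFP (pairE natE strE) (rawE natE) posRange := by
  have hn : CodeFP (pairE natE strE) natE (fun p => p.1) := fst _ _
  have hN : CodeFP (pairE natE strE) natE (fun p => nvars p.1) :=
    (natAdd.comp ((natMul.comp ((const _ 2).pair hn)).pair (const _ 1))).congr fun _ => rfl
  have hNN : CodeFP (pairE natE strE) natE (fun p => nvars p.1 * nvars p.1) :=
    (natMul.comp (hN.pair hN)).congr fun _ => rfl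
  exact ((brange unitE).comp (budgetFP.pair hNN)).congr fun _ => rfl

/-- **One slice on codes.** [cite: BlaserIkenmeyerLysikovPandeySchreyer2019, Thm. 34 (proof)] [cite: AroraBarak2009, §1.3] -/
theorem rowFP : CodeFP (pairE (pairE natE strE) (pairE natE natE)) (rawE smE) (fun s => rowCapped s.1 s.2) :=
  ((CodeFP.map basisEntryFP).comp ((CodeFP.id _).pair (posRangeFP.comp (fst _ _)))).congr fun _ => rfl

/-- **The free-coordinate test on codes.** [cite: BlaserIkenmeyerLysikovPandeySchreyer2019, Thm. 34 (proof)] [cite: AroraBarak2009, §1.3] -/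
theorem isFreeFP : CodeFP (pairE (pairE natE strE) (pairE natE natE)) bitE (fun s => isFree s.1.1 s.1.2 s.2) := by
  have hn : CodeFP (pairE (pairE natE strE) (pairE natE natE)) natE (fun s => s.1.1) := (fst _ _).fst'
  have hb : CodeFP (pairE (pairE natE strE) (pairE natE natE)) strE (fun s => s.1.2) := (fst _ _).snd'
  have hp1 : CodeFP (pairE (pairE natE strE) (pairE natE natE)) natE (fun s => s.2.1) := (snd _ _).fst'
  have hp2 : CodeFP (pairE (pairE natE strE) (pairE natE natE)) natE (fun s => s.2.2) := (snd _ _).snd'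
  have hN : CodeFP (pairE (pairE natE strE) (pairE natE natE)) natE (fun s => nvars s.1.1) :=
    (natAdd.comp ((natMul.comp ((const _ 2).pair hn)).pair (const _ 1))).congr fun _ => rfl
  have h2n : CodeFP (pairE (pairE natE strE) (pairE natE natE)) natE (fun s => 2 * s.1.1) :=
    (natMul.comp ((const _ 2).pair hn)).congr fun _ => rfl
  have hsub : CodeFP (pairE (pairE natE strE) (pairE natE natE)) natE (fun s => s.2.2 - s.1.1) :=
    (natSub.comp (hp2.pair hn)).congr fun _ => rfl
  have t1 := natLe.comp (hp1.pair hp2)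
  have t2 := natLt.comp (hp2.pair hN)
  have t3 := (natLt.comp (hp1.pair hn)).and (natEq.comp (hp2.pair (natAdd.comp (hn.pair hp1))))
  have t4 := (natEq.comp (hp2.pair h2n)).and (natLt.comp (hp1.pair h2n))
  have t5 := ((((natLt.comp (hp1.pair hn)).and (natLe.comp (hn.pair hp2))).and (natLt.comp (hp2.pair h2n))).and
    (natLt.comp (hp1.pair hsub))).and (strGetDNat.comp (hb.pair (natAdd.comp (hsub.pair (natMul.comp (hn.pair hp1))))))
  exact ((((t1.and t2).and t3.not).and t4.not).and t5.not).congr fun _ => rfl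

/-- **The free list on codes.** [cite: BlaserIkenmeyerLysikovPandeySchreyer2019, Thm. 34 (proof)] [cite: AroraBarak2009, §1.3] -/
theorem freeListFP : CodeFP (pairE natE strE) (rawE (pairE natE natE)) freeListCapped := by
  have hn : CodeFP (pairE (pairE natE strE) natE) natE (fun c => c.1.1) := (fst _ _).fst'
  have ht : CodeFP (pairE (pairE natE strE) natE) natE (fun c => c.2) := snd _ _
  have hN : CodeFP (pairE (pairE natE strE) natE) natE (fun c => nvars c.1.1) :=
    (natAdd.comp ((natMul.comp ((const _ 2).pair hn)).pair (const _ 1))).congr fun _ => rfl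
  have hg : CodeFP (pairE (pairE natE strE) natE) (pairE natE natE) (fun c => (c.2 / nvars c.1.1, c.2 % nvars c.1.1)) :=
    (natDiv.comp (ht.pair hN)).pair (natMod.comp (ht.pair hN))
  have hpairs : CodeFP (pairE natE strE) (rawE (pairE natE natE))
      (fun p => (posRange p).map fun t => (t / nvars p.1, t % nvars p.1)) :=
    ((CodeFP.map hg).comp ((CodeFP.id _).pair posRangeFP)).congr fun _ => rfl
  exact ((CodeFP.filter isFreeFP).comp ((CodeFP.id _).pair hpairs)).congr fun _ => rfl

/-- **The capped instance on codes.** [cite: BlaserIkenmeyerLysikovPandeySchreyer2019, Thm. 34 (proof)] [cite: AroraBarak2009, §1.3] -/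
theorem inst1CappedFP : CodeFP (pairE natE strE) instE inst1Capped := by
  have hn : CodeFP (pairE natE strE) natE (fun p => p.1) := fst _ _
  have hN : CodeFP (pairE natE strE) natE (fun p => nvars p.1) :=
    (natAdd.comp ((natMul.comp ((const _ 2).pair hn)).pair (const _ 1))).congr fun _ => rfl
  have hK : CodeFP (pairE natE strE) natE (fun p => (freeListCapped p).length) :=
    (natLength (pairE natE natE)).comp freeListFP
  have hrows : CodeFP (pairE natE strE) (rawE (rawE smE)) (fun p => (freeListCapped p).map (rowCapped p)) :=
    ((CodeFP.map rowFP).comp ((CodeFP.id _).pair freeListFP)).congr fun _ => rfl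
  have hentries : CodeFP (pairE natE strE) (listE smE) (fun p => ((freeListCapped p).map (rowCapped p)).flatten) :=
    ((listOfRaw smE).comp ((CodeFP.flatten smE).comp hrows)).congr fun _ => rfl
  exact (hN.pair (hK.pair (hentries.pair (const _ 1)))).congr fun _ => rfl

/-- The killing-slot test on codes. [cite: BlaserIkenmeyerLysikovPandeySchreyer2019, Thm. 33 (proof)] [cite: AroraBarak2009, §1.3] -/
theorem killAtFP : CodeFP (pairE (pairE natE strE) natE) bitE (fun c => killAt c.1.1 c.1.2 c.2) := by
  have hn : CodeFP (pairE (pairE natE strE) natE) natE (fun c => c.1.1) := (fst _ _).fst'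
  have hb : CodeFP (pairE (pairE natE strE) natE) strE (fun c => c.1.2) := (fst _ _).snd'
  have hq : CodeFP (pairE (pairE natE strE) natE) natE (fun c => c.2) := snd _ _
  have hu : CodeFP (pairE (pairE natE strE) natE) natE (fun c => c.2 / c.1.1) := (natDiv.comp (hq.pair hn)).congr fun _ => rfl
  have hw : CodeFP (pairE (pairE natE strE) natE) natE (fun c => c.2 % c.1.1) := (natMod.comp (hq.pair hn)).congr fun _ => rfl
  have hbit₁ : CodeFP (pairE (pairE natE strE) natE) bitE (fun c => c.1.2.getD c.2 false) :=
    (strGetDNat.comp (hb.pair hq)).congr fun _ => rfl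
  have hbit₂ : CodeFP (pairE (pairE natE strE) natE) bitE (fun c => c.1.2.getD (c.2 / c.1.1 + c.1.1 * (c.2 % c.1.1)) false) :=
    (strGetDNat.comp (hb.pair (natAdd.comp (hu.pair (natMul.comp (hn.pair hw)))))).congr fun _ => rfl
  exact (hbit₁.and ((natEq.comp (hu.pair hw)).or hbit₂.not)).congr fun _ => rfl

/-- **The code test on strings.** [cite: AroraBarak2009, §0.1] [cite: AroraBarak2009, §1.3] -/
theorem guard1FP : CodeFP strE bitE guard1 := by
  have hhdr : CodeFP strE (pairE natE strE) hdrOf := codeFP_hdrBody.congr fun _ => rfl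
  have hn : CodeFP (pairE natE strE) natE (fun p => p.1) := fst _ _
  have hrange : CodeFP (pairE natE strE) (rawE natE)
      (fun p => List.range (min (p.1 * p.1) (List.replicate (budget p.2) ()).length)) :=
    ((brange unitE).comp (budgetFP.pair (natMul.comp (hn.pair hn)))).congr fun _ => rfl
  have hall : CodeFP (pairE natE strE) bitE (fun p =>
      (List.range (min (p.1 * p.1) (List.replicate (budget p.2) ()).length)).all fun q => !killAt p.1 p.2 q) :=
    ((CodeFP.all killAtFP.not).comp ((CodeFP.id _).pair hrange)).congr fun _ => rfl
  exact (isGCodeFP.and (hall.comp hhdr)).congr fun _ => rfl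

/-- The header of a guarded string is graph-shaped. [folklore] -/
private theorem length_of_guard1 {w : List Bool} (h : guard1 w = true) :
    (hdrOf w).2.length = (hdrOf w).1 * (hdrOf w).1 := by
  unfold guard1 isGCode at h
  simp only [Bool.and_eq_true, decide_eq_true_eq] at h
  exact h.1.2

/-- **The instance map `reduce1` is computed on codes by a polynomial-time string function.**
[cite: BlaserIkenmeyerLysikovPandeySchreyer2019, Cor. 35] [cite: AroraBarak2009, §1.3] -/
theorem reduce1FP : CodeFP strE instE reduce1 := by
  have hhdr : CodeFP strE (pairE natE strE) hdrOf := codeFP_hdrBody.congr fun _ => rfl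
  refine ((guard1FP.ite (inst1CappedFP.comp hhdr) (const _ bad1)).congr fun w => ?_)
  unfold reduce1
  by_cases h : guard1 w = true
  · rw [if_pos h, if_pos h]
    exact inst1Capped_eq (length_of_guard1 h)
  · rw [if_neg h, if_neg h]

end Machine

/-! ### §D. `THREECOL ≤ₚ HMinRank1` and the discharge -/

section Assembly

open Brick

variable (F : Type u) [Field F]

/-- Bits of a block of length `n²` by row-major position are `ChromaticNP.bitOf`. [folklore] -/
private theorem getD_eq_bitOf {n : ℕ} (b : List Bool) (h : b.length = n * n) (u w : Fin n) :
    b.getD (w + n * u) false = ChromaticNP.bitOf b h u w := by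
  unfold ChromaticNP.bitOf
  rw [List.getD_eq_getElem]
  · rfl

/-- The header of a graph code. [folklore] -/
private theorem hdrOf_encode (n : ℕ) (G : SimpleGraph (Fin n)) :
    hdrOf (encodingGraph.encode ⟨n, G⟩) = (n, (encodingGraphFin n).encode G) := by
  rw [encodingGraph_encode, hdrOf, fstF_boolPair, sndF_boolPair, bitsToNat_encodeNat]

/-- **Graph codes have no killing slot** (the adjacency matrix is symmetric and irreflexive).
[cite: BlaserIkenmeyerLysikovPandeySchreyer2019, Thm. 33 (proof)] -/
theorem killAt_encode (n : ℕ) (G : SimpleGraph (Fin n)) {q : ℕ} (hq : q < n * n) :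
    killAt n ((encodingGraphFin n).encode G) q = false := by
  have hn : 0 < n := Nat.pos_of_ne_zero fun h => by subst h; omega
  have hu : q / n < n := Nat.div_lt_of_lt_mul (by rwa [Nat.mul_comm] at hq ⊢)
  have hw : q % n < n := Nat.mod_lt _ hn
  have hlen := ChromaticNP.length_encodingGraphFin_encode G
  unfold killAt
  rw [show ((encodingGraphFin n).encode G).getD q false =
      ((encodingGraphFin n).encode G).getD (q % n + n * (q / n)) false by rw [Nat.mod_add_div],
    getD_eq_bitOf _ hlen ⟨q / n, hu⟩ ⟨q % n, hw⟩, getD_eq_bitOf _ hlen ⟨q % n, hw⟩ ⟨q / n, hu⟩]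
  by_cases hadj : G.Adj ⟨q / n, hu⟩ ⟨q % n, hw⟩
  · have h1 := (ChromaticNP.bitOf_encode G _ _).2 hadj
    have h2 := (ChromaticNP.bitOf_encode G _ _).2 hadj.symm
    have hne : q / n ≠ q % n := fun e => G.irrefl (by rwa [show (⟨q % n, hw⟩ : Fin n) = ⟨q / n, hu⟩ from
      Fin.ext e.symm] at hadj)
    rw [h1, h2]
    simp [hne]
  · have h1 : ChromaticNP.bitOf ((encodingGraphFin n).encode G) hlen ⟨q / n, hu⟩ ⟨q % n, hw⟩ = false := by
      simpa using fun h => hadj ((ChromaticNP.bitOf_encode G _ _).1 h)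
    rw [h1, Bool.false_and]

/-- Graph codes pass the code test. [folklore] -/
private theorem guard1_encode (n : ℕ) (G : SimpleGraph (Fin n)) : guard1 (encodingGraph.encode ⟨n, G⟩) = true := by
  have hg : isGCode (encodingGraph.encode ⟨n, G⟩) = true := by
    simp only [isGCode, hdrOf_encode, Bool.and_eq_true, decide_eq_true_eq]
    exact ⟨(encodingGraph_encode ⟨n, G⟩).symm, ChromaticNP.length_encodingGraphFin_encode G⟩
  rw [guard1, hg, Bool.true_and, hdrOf_encode, List.all_eq_true]
  intro q hq
  rw [List.mem_range] at hq
  rw [killAt_encode n G (lt_of_lt_of_le hq (min_le_left _ _)), Bool.not_false]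

/-- **`reduce1` on a graph code is the instance of the graph, a yes-instance iff the graph is
3-colourable.** [cite: BlaserIkenmeyerLysikovPandeySchreyer2019, Cor. 35 (proof)] -/
theorem reduce1_encode_mem_iff (n : ℕ) (G : SimpleGraph (Fin n)) :
    reduce1 (encodingGraph.encode ⟨n, G⟩) ∈ hmr1Set F ↔ G.Colorable 3 := by
  rw [reduce1, if_pos (guard1_encode n G), hdrOf_encode]
  refine inst1Of_mem_iff F _ G fun u w => ?_
  rw [getD_eq_bitOf _ (ChromaticNP.length_encodingGraphFin_encode G)]
  exact ChromaticNP.bitOf_encode G u w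

/-- **A string whose image is a yes-instance is the code of a 3-colourable graph** (the guard
excludes non-symmetric / non-irreflexive bit matrices and everything that is not graph-shaped).
[cite: BlaserIkenmeyerLysikovPandeySchreyer2019, Cor. 35 (proof)] -/
theorem mem_THREECOL_of_reduce1_mem {w : List Bool} (hw : reduce1 w ∈ hmr1Set F) : w ∈ THREECOL := by
  unfold reduce1 at hw
  by_cases hc : guard1 w = true
  · rw [if_pos hc] at hw
    have hlen := length_of_guard1 hc
    have hc' := hc
    unfold guard1 isGCode at hc'
    simp only [Bool.and_eq_true, decide_eq_true_eq] at hc'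
    obtain ⟨⟨hpair, -⟩, hall⟩ := hc'
    rw [List.length_replicate, min_eq_left (bounds_le_budget' hlen).1, List.all_eq_true] at hall
    set n := (hdrOf w).1
    set b := (hdrOf w).2
    -- no killing slot: the bit matrix is symmetric and irreflexive
    have hslot : ∀ i j : Fin n, ChromaticNP.bitOf b hlen i j = true →
        (i : ℕ) ≠ j ∧ ChromaticNP.bitOf b hlen j i = true := by
      intro i j hij
      have hn : 0 < n := Nat.pos_of_ne_zero fun h => absurd i.2 (by omega)
      have hq : (j : ℕ) + n * i < n * n := by
        calc (j : ℕ) + n * i < n + n * i := by have := j.2; omega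
          _ = n * (i + 1) := by ring
          _ ≤ n * n := Nat.mul_le_mul_left _ (by have := i.2; omega)
      have h := hall _ (List.mem_range.2 hq)
      have hdiv : ((j : ℕ) + n * i) / n = i := by
        rw [Nat.add_mul_div_left _ _ hn, Nat.div_eq_of_lt j.2, zero_add]
      have hmod : ((j : ℕ) + n * i) % n = j := by rw [Nat.add_mul_mod_self_left, Nat.mod_eq_of_lt j.2]
      rw [killAt, hdiv, hmod, getD_eq_bitOf b hlen i j, getD_eq_bitOf b hlen j i, hij, Bool.true_and,
        Bool.not_eq_true', Bool.or_eq_false_iff, decide_eq_false_iff_not, Bool.not_eq_false'] at h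
      exact h
    have hs : ∀ i j, ChromaticNP.bitOf b hlen i j = true → ChromaticNP.bitOf b hlen j i = true :=
      fun i j h => (hslot i j h).2
    have hi : ∀ i, ¬ ChromaticNP.bitOf b hlen i i = true := fun i h => (hslot i i h).1 rfl
    set G := ChromaticNP.graphOfBits (ChromaticNP.bitOf b hlen)
    have hG : (encodingGraphFin n).encode G = b := ChromaticNP.encode_graphOfBits hlen hs hi
    have hcol : G.Colorable 3 := by
      refine (inst1Of_mem_iff F b G fun u v => ?_).1 hw
      rw [getD_eq_bitOf b hlen, ChromaticNP.graphOfBits_adj hs hi]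
    refine ⟨⟨n, G⟩, hcol, ?_⟩
    rw [encodingGraph_encode, hG]
    exact hpair
  · rw [if_neg hc] at hw
    exact absurd hw (bad1_not_mem F)

/-- **`THREECOL ≤ₚ HMinRank1_{{0,1,−1},F}`** (the Karp map of Cor 35 = Thm 33 ∘ Thm 34, on codes,
every field). [cite: BlaserIkenmeyerLysikovPandeySchreyer2019, Cor. 35] -/
theorem THREECOL_karpReducible_hmr1Language : THREECOL ≤ₚ hmr1Language F := by
  obtain ⟨f, hf, hfr⟩ := reduce1FP
  refine ⟨f, hf, fun w => ?_⟩
  have hfw : f w = tensorInstEncoding.encode (reduce1 w) := by rw [instE_eq]; exact hfr w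
  show w ∈ THREECOL ↔ f w ∈ hmr1Language F
  rw [hfw, hmr1Language_eq, Encoding.mem_toLanguage_iff]
  constructor
  · rintro ⟨⟨n, G⟩, hG, rfl⟩
    exact (reduce1_encode_mem_iff F n G).2 hG
  · exact mem_THREECOL_of_reduce1_mem F

end Assembly

end BILPS19HMinRank1

section Discharge

variable (F : Type u) [Field F]

/-- **Discharge of `BILPS2019_cor35`** (BILPS Cor 35: "`HMinRank1_{K,F}` is NP-hard", here for the
coefficient set `{0, 1, −1}` and every field `F`): GRAPH 3-COLOURABILITY is NP-hard
(`THREECOL_isNPHard`, Garey–Johnson GT4) and reduces to `hmr1Language F` by the composite of the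
printed maps of Thm 33 (graph ↦ quadratic forms) and Thm 34 (forms ↦ the tensor of a symmetric basis of
the kernel, `r = 1`) (`BILPS19HMinRank1.THREECOL_karpReducible_hmr1Language`), hardness propagating
along `≤ₚ` (`IsHard.of_reducible_holds`). [cite: BlaserIkenmeyerLysikovPandeySchreyer2019, Cor. 35] -/
theorem BILPS2019_cor35_holds : BILPS2019_cor35 F :=
  IsHard.of_reducible_holds ThreeColouring.THREECOL_isNPHard
    (BILPS19HMinRank1.THREECOL_karpReducible_hmr1Language F)

end Discharge

/-! ### §G. The general problem `HMinRank_{{0,1,−1},F}` (Problem 2) is NP-hard, every field -/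

namespace BILPS19HMinRank1

section General

variable (F : Type u) [Field F]

/-- A string is the code of a 3-colourable graph iff its image under `reduce1` is a yes-instance of
`HMinRank1`. [cite: BlaserIkenmeyerLysikovPandeySchreyer2019, Cor. 35 (proof)] -/
theorem mem_THREECOL_iff_reduce1_mem (w : List Bool) : w ∈ THREECOL ↔ reduce1 w ∈ hmr1Set F := by
  constructor
  · rintro ⟨⟨n, G⟩, hG, rfl⟩
    exact (reduce1_encode_mem_iff F n G).2 hG
  · exact mem_THREECOL_of_reduce1_mem F

/-- **`THREECOL ≤ₚ HMinRank_{{0,1,−1},F}`**: the Karp map of Cor 35 read in Problem 2 — its images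
carry `r = 1` (or are the non-member `(0, 0, [], 0)`, whose `F⁰` has no nonzero vector), so their
membership in `HMinRank` is their membership in `HMinRank1`.
[cite: BlaserIkenmeyerLysikovPandeySchreyer2019, §2.5 ("testing membership in the minrank varieties is NP-hard", p0011:L3)] -/
theorem THREECOL_karpReducible_hmrLanguage : THREECOL ≤ₚ hmrLanguage F := by
  obtain ⟨f, hf, hfr⟩ := reduce1FP
  refine ⟨f, hf, fun w => ?_⟩
  have hfw : f w = tensorInstEncoding.encode (reduce1 w) := by rw [instE_eq]; exact hfr w
  show w ∈ THREECOL ↔ f w ∈ hmrLanguage F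
  rw [hfw]
  unfold hmrLanguage
  rw [Encoding.mem_toLanguage_iff, mem_THREECOL_iff_reduce1_mem F w]
  unfold reduce1
  by_cases hc : guard1 w = true
  · rw [if_pos hc]
    simp only [hmr1Set, Set.mem_setOf_eq, inst1Of, true_and]
  · rw [if_neg hc]
    exact iff_of_false (bad1_not_mem F) fun h => by
      obtain ⟨x, hx, -⟩ := h.2
      exact hx (funext fun i => i.elim0)

end General

end BILPS19HMinRank1

section DischargeGeneral

variable (F : Type u) [Field F]

/-- **BILPS 2019, §1.1 / §2.5 — membership in the minrank varieties is NP-hard**: "We prove that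
deciding whether the minrank is bounded by some given bound `b` is an NP-hard question" (p0004:L13);
"testing membership in the minrank varieties is NP-hard … even deciding whether the minrank is `≤ 1`
is already NP-hard" (p0011:L3–L6). For the tree's Problem 2 language `hmrLanguage F` (square slices,
coefficients `{0, ±1}`) and EVERY field `F`, by the Karp map of Cor 35 (`BILPS2019_cor35_holds`; its
instances have `r = 1`). (The printed Thm 36 — hardness already for the shapes `n × (2n+1) × (2n+1)`,
`r = n + 1`, characteristic `0` — is the separate fact `BILPS2019_thm36`, NOT proved here.)
[cite: BlaserIkenmeyerLysikovPandeySchreyer2019, §1.1 (p0004:L13) and §2.5 (p0011:L3)] -/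
theorem BILPS2019_hmr_isNPHard : IsNPHard (hmrLanguage F) :=
  IsHard.of_reducible_holds ThreeColouring.THREECOL_isNPHard
    (BILPS19HMinRank1.THREECOL_karpReducible_hmrLanguage F)

end DischargeGeneral

end Literature.Barriers.ValiantsHypothesis
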